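import Mathlib
import HarnessLib
import Summits.ValiantsHypothesis.ValiantsHypothesis.Theorems.SymmetryDialPerModFour

/-!
# SymmetryDial — law (ν), first case: `per M_f mod 4` is the parity of the weight

Route `route-ValiantsHypothesis-SymmetryDial`, item A₂ = `SymHardAffineSupported`
(stmt-ValiantsHypothesis-23711), instrument P′ = `SymmetryDialAffinePebble.AffinePebblePairs`.
Supporting kernel for the decomposition workshop (lineage decomp-val-lens-1, g7) — a NEGATIVE law.

`SymmetryDialPerModFour.card_admissible_decomp` expresses `per M_f` (`M_f[x,y] = f(x+y)` over `𝔽₂^d`,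
`S = supp f`, `s = |S|`, `k_ξ = |S ∩ ker ξ|`, `k'_ξ = s - k_ξ`) as
`per M_f + (2^d - 1)s = s + Σ_{ξ ≠ 0} (k_ξ² + k'_ξ²) + Z` with `4 ∣ Z`.  This file shows that the
hyperplane term carries NO information modulo 4: for `d ≥ 3`

* `two_dvd_card_biorth` : `#{ξ : ξ·v = 0 ∧ ξ·w = 0}` is even (a subgroup of `𝔽₂^d` of index ≤ 4,
  nontrivial by pigeonhole since `2^d > 4`);
* `sum_kerCount_eq`, `sum_kerCount_sq_eq` : `Σ_ξ k_ξ = Σ_{v ∈ S} #{ξ : ξ·v = 0}` and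
  `Σ_ξ k_ξ² = Σ_{v,w ∈ S} #{ξ : ξ·v = ξ·w = 0}` (double counting), hence both are even;
* `per_grpMat_modEq_four_parity` : **`per M_f ≡ (s mod 2) (mod 4)`**, i.e. `per M_f mod 4 ∈ {0,1}` is the
  parity of the weight; consequently (`per_modEq_four_of_weight_parity`) ANY two group matrices whose
  weights have equal parity — in particular any `C²`-equivalent pair — have `per ≡ per (mod 4)`, so the
  `C³` hypothesis of `SymmetryDialPerModFour.per_modEq_four_of_pebbleEquiv_three` is not needed.

Numerically the same holds much deeper — law (ν): `per M_f ≡ [s odd] (mod 2^d)` for every `f`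
(verified: `d = 3` all `f`; `d = 4` all GL-classes (census g8) and mod 32 on samples; `d = 5` mod 32 on
samples via the Möbius expansion; `d = 8`: 49 Maiorana–McFarland bent functions mod 16), and for
nonnegative-integer group matrices over `𝔽₂^m`, `per N ≡ (row sum mod 2) (mod 2^m)` — the `𝔽₂^m` analogue of
Brualdi–Newman's `per A ≡ r (mod p)` for circulants of prime order.  Only the mod-4 case is proved here.
-/

namespace Summit.ValiantsHypothesis.ValiantsHypothesis.Theorems.SymmetryDialPerParity

open Finset Equiv
open SymmetryDialAffinePebble (V pair)
open SymmetryDialAffinePebbleThree (grpMat kerCount)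
open SymmetryDialPerCongruence (admissible two_nsmul_eq_zero)
open SymmetryDialTranslationOrbits SymmetryDialShiftPerm SymmetryDialPerModFour

variable {d : ℕ}

/-! ### 1. Duals vanishing on two given vectors -/

/-- `pair` is symmetric (file-local helper). -/
private theorem pair_comm (ξ v : V d) : pair ξ v = pair v ξ := by
  unfold pair
  exact sum_congr rfl fun i _ => mul_comm _ _

/-- Additivity of `pair` in the first argument (file-local helper; cf. `SymmetryDialAffineOrbits.add_pair` for the sibling `pair`). -/
private theorem pair_add_left (ξ η v : V d) : pair (ξ + η) v = pair ξ v + pair η v := by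
  rw [pair_comm, pair_add, pair_comm v ξ, pair_comm v η]

/-- The duals vanishing on both `v` and `w`. -/
def biorth (v w : V d) : Finset (V d) := univ.filter fun ξ => pair ξ v = 0 ∧ pair ξ w = 0

/-- Membership in `biorth v w`. -/
theorem mem_biorth {v w ξ : V d} : ξ ∈ biorth v w ↔ pair ξ v = 0 ∧ pair ξ w = 0 := by
  simp [biorth]

/-- `biorth v w` as an additive subgroup of `𝔽₂^d`. -/
def biorthGrp (v w : V d) : AddSubgroup (V d) where
  carrier := {ξ | pair ξ v = 0 ∧ pair ξ w = 0}
  zero_mem' := ⟨pair_zero_left v, pair_zero_left w⟩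
  add_mem' := fun {ξ η} hξ hη => by
    simp only [Set.mem_setOf_eq] at *
    rw [pair_add_left, pair_add_left, hξ.1, hη.1, hξ.2, hη.2, add_zero]
    exact ⟨rfl, rfl⟩
  neg_mem' := fun {ξ} hξ => by
    simp only [Set.mem_setOf_eq] at *
    rwa [neg_eq_self']

/-- Membership in `biorthGrp v w`. -/
theorem mem_biorthGrp {v w ξ : V d} : ξ ∈ biorthGrp v w ↔ pair ξ v = 0 ∧ pair ξ w = 0 := Iff.rfl

/-- Lagrange: `#biorth v w ∣ 2^d`. -/
theorem card_biorth_dvd (v w : V d) : (biorth v w).card ∣ 2 ^ d := by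
  have h1 : Nat.card (biorthGrp v w) = (biorth v w).card := by
    rw [Nat.card_congr (Equiv.subtypeEquivRight (fun ξ => mem_biorthGrp.trans mem_biorth.symm) :
      biorthGrp v w ≃ {ξ // ξ ∈ biorth v w}), Nat.card_eq_fintype_card, Fintype.card_coe]
  have h2 := AddSubgroup.card_addSubgroup_dvd_card (biorthGrp v w)
  rwa [h1, Nat.card_eq_fintype_card, card_V] at h2

/-- For `d ≥ 3` two linear conditions leave a nonzero solution (pigeonhole: `2^d > 4`). -/
theorem exists_ne_zero_mem_biorth (hd : 3 ≤ d) (v w : V d) : ∃ η, η ≠ 0 ∧ η ∈ biorth v w := by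
  have hlt : Fintype.card (Fin 2 × Fin 2) < Fintype.card (V d) := by
    rw [card_V, Fintype.card_prod, Fintype.card_fin]
    calc 2 * 2 = 2 ^ 2 := by norm_num
      _ < 2 ^ 3 := by norm_num
      _ ≤ 2 ^ d := Nat.pow_le_pow_right (by norm_num) hd
  obtain ⟨ξ₁, ξ₂, hne, heq⟩ :=
    Fintype.exists_ne_map_eq_of_card_lt (fun ξ : V d => (pair ξ v, pair ξ w)) hlt
  simp only [Prod.mk.injEq] at heq
  refine ⟨ξ₁ + ξ₂, ?_, ?_⟩
  · intro h
    apply hne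
    calc ξ₁ = ξ₁ + (ξ₂ + ξ₂) := by rw [two_nsmul_eq_zero, add_zero]
      _ = (ξ₁ + ξ₂) + ξ₂ := by rw [add_assoc]
      _ = ξ₂ := by rw [h, zero_add]
  · rw [mem_biorth, pair_add_left, pair_add_left, heq.1, heq.2, fin2_add_self, fin2_add_self]
    exact ⟨rfl, rfl⟩

/-- **Bi-orthogonal sets of duals have even size** (`d ≥ 3`). -/
theorem two_dvd_card_biorth (hd : 3 ≤ d) (v w : V d) : 2 ∣ (biorth v w).card := by
  obtain ⟨j, -, hj⟩ := (Nat.dvd_prime_pow Nat.prime_two).1 (card_biorth_dvd v w)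
  obtain ⟨η, hη0, hη⟩ := exists_ne_zero_mem_biorth hd v w
  have h2 : 2 ≤ (biorth v w).card := by
    have hsub : ({0, η} : Finset (V d)) ⊆ biorth v w := by
      intro ξ hξ
      simp only [mem_insert, mem_singleton] at hξ
      rcases hξ with rfl | rfl
      · exact mem_biorth.2 ⟨pair_zero_left v, pair_zero_left w⟩
      · exact hη
    have := card_le_card hsub
    rwa [card_pair hη0.symm] at this
  rw [hj] at h2 ⊢
  rcases j with _ | j
  · norm_num at h2
  · exact dvd_pow_self 2 (Nat.succ_ne_zero j)

/-! ### 2. Double counting the hyperplane sections -/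

/-- `k_ξ` as an indicator sum over the support. -/
theorem kerCount_eq_sum (f : V d → Bool) (ξ : V d) :
    kerCount f ξ = ∑ v ∈ supp f, if pair ξ v = 0 then 1 else 0 := by
  rw [← card_filter]
  unfold kerCount supp
  rw [filter_filter]

/-- `Σ_ξ k_ξ = Σ_{v ∈ S} #{ξ : ξ·v = 0}`. -/
theorem sum_kerCount_eq (f : V d → Bool) :
    ∑ ξ, kerCount f ξ = ∑ v ∈ supp f, (biorth v v).card := by
  simp_rw [kerCount_eq_sum]
  rw [sum_comm]
  refine sum_congr rfl fun v _ => ?_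
  rw [biorth, card_filter]
  exact sum_congr rfl fun ξ _ => by simp only [and_self]

/-- `Σ_ξ k_ξ² = Σ_{v,w ∈ S} #{ξ : ξ·v = 0 ∧ ξ·w = 0}`. -/
theorem sum_kerCount_sq_eq (f : V d → Bool) :
    ∑ ξ, kerCount f ξ ^ 2 = ∑ v ∈ supp f, ∑ w ∈ supp f, (biorth v w).card := by
  have hsq : ∀ ξ : V d, kerCount f ξ ^ 2 =
      ∑ v ∈ supp f, ∑ w ∈ supp f, if pair ξ v = 0 ∧ pair ξ w = 0 then 1 else 0 := by
    intro ξ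
    rw [sq, kerCount_eq_sum, sum_mul_sum]
    refine sum_congr rfl fun v _ => sum_congr rfl fun w _ => ?_
    by_cases hv : pair ξ v = 0 <;> by_cases hw : pair ξ w = 0 <;> simp [hv, hw]
  simp_rw [hsq]
  rw [sum_comm]
  refine sum_congr rfl fun v _ => ?_
  rw [sum_comm]
  refine sum_congr rfl fun w _ => ?_
  rw [biorth, card_filter]

/-- `Σ_ξ k_ξ` is even (`d ≥ 3`). -/
theorem two_dvd_sum_kerCount (hd : 3 ≤ d) (f : V d → Bool) : 2 ∣ ∑ ξ, kerCount f ξ := by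
  rw [sum_kerCount_eq]
  exact dvd_sum fun v _ => two_dvd_card_biorth hd v v

/-- `Σ_ξ k_ξ²` is even (`d ≥ 3`). -/
theorem two_dvd_sum_kerCount_sq (hd : 3 ≤ d) (f : V d → Bool) : 2 ∣ ∑ ξ, kerCount f ξ ^ 2 := by
  rw [sum_kerCount_sq_eq]
  exact dvd_sum fun v _ => dvd_sum fun w _ => two_dvd_card_biorth hd v w

/-- `Σ_{ξ ≠ 0} k_ξ k'_ξ` is even (`d ≥ 3`): with `A = Σ_{ξ≠0} k_ξ`, `B = Σ_{ξ≠0} k_ξ²`,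
`Q + B = s·A`, and `s + A`, `s² + B` are the even numbers `Σ_ξ k_ξ`, `Σ_ξ k_ξ²`. -/
theorem two_dvd_sum_kerCount_mul_coKerCount (hd : 3 ≤ d) (f : V d → Bool) :
    2 ∣ ∑ ξ ∈ univ.erase (0 : V d), kerCount f ξ * coKerCount f ξ := by
  set s := (supp f).card with hs
  set P := univ.erase (0 : V d) with hP
  set Q := ∑ ξ ∈ P, kerCount f ξ * coKerCount f ξ with hQ
  set A := ∑ ξ ∈ P, kerCount f ξ with hA
  set B := ∑ ξ ∈ P, kerCount f ξ ^ 2 with hB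
  have hQB : Q + B = s * A := by
    rw [hQ, hB, hA, ← sum_add_distrib, mul_sum]
    refine sum_congr rfl fun ξ _ => ?_
    rw [coKerCount_eq, sq, ← mul_add, Nat.sub_add_cancel (kerCount_le f ξ), mul_comm]
  have hsA : 2 ∣ s + A := by
    have h := two_dvd_sum_kerCount hd f
    rwa [← add_sum_erase _ _ (mem_univ (0 : V d)), kerCount_zero_eq] at h
  have hsB : 2 ∣ s ^ 2 + B := by
    have h := two_dvd_sum_kerCount_sq hd f
    rwa [← add_sum_erase _ _ (mem_univ (0 : V d)), kerCount_zero_eq] at h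
  have h1 : (Q : ZMod 2) + B = s * A := by exact_mod_cast congrArg (Nat.cast : ℕ → ZMod 2) hQB
  have h2 : (s : ZMod 2) + A = 0 := by
    exact_mod_cast (ZMod.natCast_eq_zero_iff (s + A) 2).2 hsA
  have h3 : (s : ZMod 2) ^ 2 + B = 0 := by
    exact_mod_cast (ZMod.natCast_eq_zero_iff (s ^ 2 + B) 2).2 hsB
  have hQ0 : (Q : ZMod 2) = 0 := by linear_combination h1 + (s : ZMod 2) * h2 - h3
  exact (ZMod.natCast_eq_zero_iff Q 2).1 hQ0

/-! ### 3. `per M_f mod 4` is the parity of the weight -/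

/-- `Σ_{ξ≠0} (k_ξ² + k'_ξ²) + 2·Σ_{ξ≠0} k_ξ k'_ξ = (2^d − 1)·s²`. -/
theorem sum_sq_add_two_mul (f : V d → Bool) :
    (∑ ξ ∈ univ.erase (0 : V d), (kerCount f ξ ^ 2 + coKerCount f ξ ^ 2)) +
      2 * ∑ ξ ∈ univ.erase (0 : V d), kerCount f ξ * coKerCount f ξ =
      (2 ^ d - 1) * (supp f).card ^ 2 := by
  rw [mul_sum, ← sum_add_distrib]
  have h : ∀ ξ ∈ univ.erase (0 : V d),
      kerCount f ξ ^ 2 + coKerCount f ξ ^ 2 + 2 * (kerCount f ξ * coKerCount f ξ) = (supp f).card ^ 2 := by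
    intro ξ _
    rw [← kerCount_add_coKerCount f ξ]; ring
  rw [sum_congr rfl h, sum_const, card_erase_of_mem (mem_univ _), card_univ, card_V, smul_eq_mul]

/-- In `ZMod 4`: `2^d − 1 = −1` for `d ≥ 2`. -/
theorem cast_two_pow_sub_one (hd : 2 ≤ d) : ((2 ^ d - 1 : ℕ) : ZMod 4) = -1 := by
  obtain ⟨e, rfl⟩ := Nat.exists_eq_add_of_le hd
  have h2 : ((2 : ℕ) : ZMod 4) ^ (2 + e) = 0 := by
    rw [pow_add, show ((2 : ℕ) : ZMod 4) ^ 2 = 0 from by decide, zero_mul]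
  rw [Nat.cast_sub Nat.one_le_two_pow, Nat.cast_pow, h2, Nat.cast_one, zero_sub]

/-- **Law (ν), mod 4.**  For `d ≥ 3` and every `f : 𝔽₂^d → {0,1}`:
`per M_f ≡ (|supp f| mod 2) (mod 4)` — the permanent of a group matrix over `𝔽₂^d` is `0` or `1`
modulo 4 according to the parity of its row sum.  The hyperplane-profile term of (θ₁) is invisible mod 4. -/
theorem per_grpMat_modEq_four_parity (hd : 3 ≤ d) (f : V d → Bool) :
    (admissible (grpMat f)).card ≡ (supp f).card % 2 [MOD 4] := by
  obtain ⟨T, hT⟩ : ∃ T : ℕ,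
      (∑ ξ ∈ univ.erase (0 : V d), (kerCount f ξ ^ 2 + coKerCount f ξ ^ 2)) = T := ⟨_, rfl⟩
  obtain ⟨Q, hQ⟩ : ∃ Q : ℕ,
      (∑ ξ ∈ univ.erase (0 : V d), kerCount f ξ * coKerCount f ξ) = Q := ⟨_, rfl⟩
  have hdec := card_admissible_decomp f
  obtain ⟨m, hm⟩ := four_dvd_card_rest f
  rw [hm, hT] at hdec
  obtain ⟨q, hq⟩ := two_dvd_sum_kerCount_mul_coKerCount hd f
  rw [hQ] at hq
  have hTQ := sum_sq_add_two_mul f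
  rw [hT, hQ, hq] at hTQ
  have hc := cast_two_pow_sub_one (le_trans (by norm_num) hd)
  generalize (supp f).card = s at hdec hTQ ⊢
  generalize (admissible (grpMat f)).card = p at hdec ⊢
  -- cast to ZMod 4
  have e1 : (p : ZMod 4) + ((2 ^ d - 1 : ℕ) : ZMod 4) * s = s + T + 4 * m := by
    exact_mod_cast congrArg (Nat.cast : ℕ → ZMod 4) hdec
  have e2 : (T : ZMod 4) + 2 * (2 * q) = ((2 ^ d - 1 : ℕ) : ZMod 4) * s ^ 2 := by
    exact_mod_cast congrArg (Nat.cast : ℕ → ZMod 4) hTQ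
  rw [hc] at e1 e2
  have h4 : (4 : ZMod 4) = 0 := by decide
  have eper : (p : ZMod 4) = 2 * s - s ^ 2 := by
    linear_combination e1 + e2 + ((m : ZMod 4) - q) * h4
  -- evaluate `2s - s²` on `s mod 4`
  have hmod : (p : ZMod 4) = ((s % 2 : ℕ) : ZMod 4) := by
    rw [eper, ← ZMod.natCast_mod s 4, ← Nat.mod_mod_of_dvd s (by norm_num : 2 ∣ 4)]
    have hr : s % 4 < 4 := Nat.mod_lt _ (by norm_num)
    generalize s % 4 = r at hr ⊢
    interval_cases r <;> decide
  exact (ZMod.natCast_eq_natCast_iff _ _ 4).1 hmod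

/-- Hence `per M_f ≡ per M_g (mod 4)` for ANY two group matrices of equal weight parity (`d ≥ 3`) —
the `C³` hypothesis of `per_modEq_four_of_pebbleEquiv_three` is unnecessary; `C²` (equal weight) suffices. -/
theorem per_modEq_four_of_weight_parity (hd : 3 ≤ d) (f g : V d → Bool)
    (h : (supp f).card % 2 = (supp g).card % 2) :
    (admissible (grpMat f)).card ≡ (admissible (grpMat g)).card [MOD 4] :=
  ((per_grpMat_modEq_four_parity hd f).trans (by rw [h])).trans
    (per_grpMat_modEq_four_parity hd g).symm

end Summit.ValiantsHypothesis.ValiantsHypothesis.Theorems.SymmetryDialPerParity
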